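import Mathlib
import Literature.Analysis.FluidPDE.ClassicalSolution
import Literature.Analysis.FluidPDE.LerayHopf
import Summits.NavierStokesRegularity.NavierStokesRegularity.Theses.L3TimeExponentPincer
import Summits.NavierStokesRegularity.NavierStokesRegularity.Theorems.L3TimeExponentPincerEffNode
import Summits.NavierStokesRegularity.NavierStokesRegularity.Theorems.L3TimeExponentPincerPaceDichotomy
import Summits.NavierStokesRegularity.NavierStokesRegularity.Theorems.L3TimeExponentPincerEffSatBlowupStubParabolicConcentrationBlowup
import Summits.NavierStokesRegularity.NavierStokesRegularity.Theorems.L3TimeExponentPincerMorreyTypeIDissipationPace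
import HarnessLib.Audit
import HarnessLib

/-!
# Node «Type-I dissipation on the Morrey-Type-I class» and its kernel bridges to stub 2 of line `pace` —
# crux `EffSatBlowup` (route `L3TimeExponentPincer`, item `stmt-NavierStokesRegularity-19139`)

Node file (seat ns-pincer-19139-p1, lead of line `pace`; `--supports stmt-NavierStokesRegularity-19139`).  It TYPES
the statement to which this seat reduced the registered stub `stub_morreyTypeI_slow` (= node `MorreyTypeISlowB`:
Morrey-Type-I frame blow-ups are `L³`-slow), namely

* `DissipationTypeIOnMTIB` (OPEN, `@[conjecture]`): every frame blow-up of the class `MorreyTypeINear u T` has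
  TYPE-I DISSIPATION near `T`: `∫|∇u(t)|² ≤ D₀/(T-t)` on a final window.  (The self-similar / Leray rate of
  `‖∇u(t)‖₂²` is `(T-t)^{-1/2}`, so the node allows twice that exponent; its failure set is log-null for every
  Leray–Hopf solution by the energy inequality; not in print for any class short of sup-Type-I-with-profile scenarios.)

and records the kernel bridges (all from the landed `l3Slow_of_morreyTypeINear_of_dissipationTypeI`, p460580, i.e.
the one-scale localized interpolation inequality p459602):
`morreyTypeISlowB_of_dissipationTypeIOnMTIB : DissipationTypeIOnMTIB → MorreyTypeISlowB` (stub 2's node BY NAME),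
`effSatBlowupMTI_of_dissipationTypeIOnMTIB : DissipationTypeIOnMTIB → EffSatBlowupMTI` (the crux on the MTI class),
`fastTimesFatB_of_dissipationTypeIOnMTIB_of_stub3` (with stub 3's registered statement as hypothesis, the node
gives `FastTimesFatB`, hence the crux via `effSatBlowup_iff_fastTimesFatB'`).

Ladder on the Morrey-Type-I class (kernel, by name): `DissipationTypeIOnMTIB ⟹ MorreyTypeISlowB ⟺ EffSatBlowupMTI`
(the `⟸` of the last equivalence is `morreyTypeISlowB_of_effSatBlowupMTI`, p417816).  The node is STRONGER than
stub 2 a priori; it is filed as a named handle for planners/disprovers (a Morrey-Type-I blow-up with enstrophy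
`≫ (T-t)⁻¹` at a sequence of times would refute the node but not necessarily stub 2).

WHAT THIS IS NOT: not a claim about Navier–Stokes regularity or blow-up; one open node (tagged `conjecture`, used only
as a hypothesis) and proved implications; the crux and stubs 2–3 of line `pace` stay open.

References: T. Barker, C. Prange, ARMA 236 (2020) = arXiv:1812.09115, (1.7) [BarkerPrange2020]; J. Leray, Acta Math.
63 (1934) [Leray1934]; L. Caffarelli, R. Kohn, L. Nirenberg, CPAM 35 (1982), §2 [CaffarelliKohnNirenberg1982].
-/

noncomputable section

open MeasureTheory Set Function Filter Metric Topology
open scoped ENNReal NNReal Topology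
open Literature.Analysis.FluidPDE
open Summit.NavierStokesRegularity.NavierStokesRegularity.Theorems.L3TimeExponentPincerEffNode
open Summit.NavierStokesRegularity.NavierStokesRegularity.Theorems.L3TimeExponentPincerPaceDichotomy
open Summit.NavierStokesRegularity.NavierStokesRegularity.Theorems.L3TimeExponentPincerStubParabolicConcentration
open Summit.NavierStokesRegularity.NavierStokesRegularity.Theorems.L3TimeExponentPincerMorreyTypeIDissipationPace

namespace Summit.NavierStokesRegularity.NavierStokesRegularity.Theorems.L3TimeExponentPincerDissipationNode

/-- **Node (OPEN) — Type-I dissipation on the Morrey-Type-I class.**  Every frame blow-up (classical on `[0,T)`,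
Leray–Hopf from a rapidly decaying datum, no smooth extension past `T`) with `MorreyTypeINear u T` has
`∫|∇u(t)|² ≤ D₀/(T-t)` on a final window.  Tagged `conjecture`: used only as a hypothesis; the self-similar rate is
`(T-t)^{-1/2}` (Leray 1934), so the node allows twice the self-similar exponent. [cite: Leray1934, (3.13)–(3.14)] -/
@[conjecture] def DissipationTypeIOnMTIB : Prop :=
  ∀ (ν T : ℝ), 0 < ν → 0 < T →
    ∀ (u : ℝ → EuclideanSpace ℝ (Fin 3) → EuclideanSpace ℝ (Fin 3)) (p : ℝ → EuclideanSpace ℝ (Fin 3) → ℝ),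
      IsClassicalNSSolutionOn (Ico 0 T) ν 0 u p → IsLerayHopfOn T ν 0 (u 0) u →
      HasRapidSpatialDecay (u 0) → ¬ HasSmoothExtensionPast ν 0 u T → MorreyTypeINear u T →
      ∃ D₀ : ℝ, 0 < D₀ ∧ ∃ T₂ < T, ∀ t ∈ Ioo T₂ T,
        ∫⁻ x, ENNReal.ofReal (frobeniusNormSq (fderiv ℝ (u t) x)) ≤ ENNReal.ofReal (D₀ / (T - t))

/-- **The node implies stub 2's node `MorreyTypeISlowB` BY NAME** (one-scale localized interpolation, p460580).
[cite: CaffarelliKohnNirenberg1982, §2 (2.8)–(2.10)] -/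
theorem morreyTypeISlowB_of_dissipationTypeIOnMTIB (h : DissipationTypeIOnMTIB) : MorreyTypeISlowB := by
  intro ν T hν hT u p hsol hLH hdec hnext hMor
  exact l3Slow_of_morreyTypeINear_of_dissipationTypeI hν hT hsol hLH hMor (h ν T hν hT u p hsol hLH hdec hnext hMor)

/-- **The node implies the crux on the Morrey-Type-I class** (`EffSatBlowupMTI`), via the landed stub 1.
[cite: CaffarelliKohnNirenberg1982, §2 (2.8)–(2.10)] -/
theorem effSatBlowupMTI_of_dissipationTypeIOnMTIB (h : DissipationTypeIOnMTIB) : EffSatBlowupMTI :=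
  effSatBlowupMTI_iff_morreyTypeISlowB'.2 (morreyTypeISlowB_of_dissipationTypeIOnMTIB h)

/-- **With stub 3, the node gives the fast-times node `FastTimesFatB`** (stub 3's registered statement taken as a
hypothesis, exactly as in the skeleton's `fastTimesFatB_of_stubs`), hence the crux by `effSatBlowup_iff_fastTimesFatB'`.
[cite: CaffarelliKohnNirenberg1982, §2 (2.8)–(2.10)] -/
theorem fastTimesFatB_of_dissipationTypeIOnMTIB_of_stub3 (h : DissipationTypeIOnMTIB)
    (h3 : ∀ (ν T : ℝ), 0 < ν → 0 < T →
      ∀ (u : ℝ → EuclideanSpace ℝ (Fin 3) → EuclideanSpace ℝ (Fin 3)) (p : ℝ → EuclideanSpace ℝ (Fin 3) → ℝ),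
        IsClassicalNSSolutionOn (Ico 0 T) ν 0 u p → IsLerayHopfOn T ν 0 (u 0) u →
        HasRapidSpatialDecay (u 0) → ¬ HasSmoothExtensionPast ν 0 u T → ¬ MorreyTypeINear u T →
        FastTimesFat u T) :
    FastTimesFatB := by
  intro ν T hν hT u p hsol hLH hdec hnext
  by_cases hM : MorreyTypeINear u T
  · obtain ⟨A, hA, T₁, hT₁, hslow⟩ :=
      morreyTypeISlowB_of_dissipationTypeIOnMTIB h ν T hν hT u p hsol hLH hdec hnext hM
    refine ⟨A, hA, 1, one_pos, 1, one_pos, 1, one_pos, T₁, hT₁, fun t ht hfast => ?_⟩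
    exact absurd (lt_of_lt_of_le hfast (hslow t ht)) (lt_irrefl _)
  · exact h3 ν T hν hT u p hsol hLH hdec hnext hM

/-- **The crux from the node and stub 3** (composition by name). [cite: CaffarelliKohnNirenberg1982, §2 (2.8)–(2.10)] -/
theorem effSatBlowup_of_dissipationTypeIOnMTIB_of_stub3 (h : DissipationTypeIOnMTIB)
    (h3 : ∀ (ν T : ℝ), 0 < ν → 0 < T →
      ∀ (u : ℝ → EuclideanSpace ℝ (Fin 3) → EuclideanSpace ℝ (Fin 3)) (p : ℝ → EuclideanSpace ℝ (Fin 3) → ℝ),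
        IsClassicalNSSolutionOn (Ico 0 T) ν 0 u p → IsLerayHopfOn T ν 0 (u 0) u →
        HasRapidSpatialDecay (u 0) → ¬ HasSmoothExtensionPast ν 0 u T → ¬ MorreyTypeINear u T →
        FastTimesFat u T) :
    Summit.NavierStokesRegularity.NavierStokesRegularity.Theses.L3TimeExponentPincer.EffSatBlowup :=
  effSatBlowup_iff_fastTimesFatB'.2 (fastTimesFatB_of_dissipationTypeIOnMTIB_of_stub3 h h3)

end Summit.NavierStokesRegularity.NavierStokesRegularity.Theorems.L3TimeExponentPincerDissipationNode

end
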